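/-
Copyright: the b2b-balaban T⁴-continuum CRUX team, row NE7b OWNER lineage `t4-ne7b-p1` (gen 140). Project licence.
-/
import Summits.QuantumFields.BalabanUV.T4Continuum.Spine.NE7b.SupDobrushinWeightedNeumann
import Mathlib.Algebra.BigOperators.Field
import Mathlib.Data.Matrix.Basic

/-!
# THE DECAY OF DOBRUSHIN'S BILINEAR BOUND (SCOPING (d11)(2)∕(4)): (447)'s estimate `|Cov_ν(F,G)| ≤ B(a,b) = Σ_w (Dᵀa)_w(Dᵀb)_w∕c_w` DECAYS
# in the distance between the observables' supports.  With a SYMMETRIC SUBMULTIPLICATIVE WEIGHT `θ ≥ 1` (`θ_{xz} ≤ θ_{xy}θ_{yz}`, e.g.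
# `e^{μd}`), the WEIGHTED letters of `D` — rows `Σ_wD_{zw}θ_{zw} ≤ dθ` ((453)) and COLUMNS `Σ_zD_{zw}θ_{zw} ≤ dθ′` (this file, by transposition)
# — and the observables' weighted profiles (`Σ_z a_zθ_{xz} ≤ αθ`: `F` lives near `x`; `b_zθ_{zy} ≤ βθ`: `G` lives near `y`) give
#   `θ_{xy}·B(a,b) ≤ αθ·dθ·βθ·dθ′∕cmin`,   i.e.   `|Cov_ν(F_x, G_y)| ≤ K∕θ_{xy}`
# — Gross∕Künsch∕Föllmer's rate; with (459) the output Hessian's ENTRY decays like `θ⁻¹`, and with (461) the third cumulant decays along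
# the tree (row NE7b, node U5c; (448), (453) BY NAME; [folklore])

Cell `pub-balaban`, sub-cell `t4`, spine estimate NE7b (`T4WeightBudget.RelWeightBound`; the cell's OWN estimate — NOT PRINTED in
[Bałaban 1983–89], NOT PROVED).  Crux-route work under `Spine/NE7b/` by the row OWNER (`t4-ne7b-p1` gen 140, file (462)) under FREEZE
(0)'s crux-prover clause; NOTHING of Bałaban's is named as a Lean object, valued or asserted; no `T4Continuum/Support` leaf typed; no
`def`, no notation; zero `sorry`.  Imports (BY NAME): the OWNER's (453) `…SupDobrushinWeightedNeumann` (`pow_weighted_rowsum_le`,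
`neumann_weighted_rowsum_le`, `rowsum_le_weighted`; through it (448) `summable_pow_entry`, `pow_entry_nonneg`).

WHAT IS PROVED ([folklore]; `C : Matrix ι ι ℝ` nonnegative, `θ ≥ 1`, `θ_{xx} = 1`, `θ_{xz} ≤ θ_{xy}θ_{yz}`):
* §1 the column twins of (453) by transposition: `transpose_pow_apply`, **`pow_weighted_colsum_le`** (`Σ_x(C^n)_{xw}θ_{xw} ≤ γθ′^n`),
  **`neumann_weighted_colsum_le`** (`Σ_xD_{xw}θ_{xw} ≤ (1−γθ′)⁻¹`, `D = Σ_nC^n`).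
* §2 the weighted profiles propagate: `weighted_profile_row` (`θ_{xw}(Dᵀa)_w ≤ Σ_z (a_zθ_{xz})(D_{zw}θ_{zw})`), `weighted_profile_sup`
  (`θ_{wy}(Dᵀb)_w ≤ βθ·Σ_zD_{zw}θ_{zw}`).
* §3 THE END **`bilinear_weighted_le`** (`θ_{xy}·B(a,b) ≤ αθ·dθ·βθ·dθ′∕cmin`) and **`bilinear_decay`** (`B(a,b) ≤ αθ·dθ·βθ·dθ′∕(cmin·θ_{xy})`).
* §4 toy: the trivial weight.

HONEST (what this is NOT).  Abstract letters: the weighted letters of the road's whitened Dobrushin matrix (`C = HA∕(1−lamA)`, i.e. weights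
compatible between the field index `ι` and the sampler index `κ` through the factor `A`) and of the observables' profiles `Σ_u|A_{uw}|Hk_{xu}`
are the successor's instantiation; so is the third-order tree sum.  Scalar skeleton ((A3), NC-NE7b-α UNRULED); nothing of Bałaban's asserted.
BY-NAME EFFECT ON THE WALL: NONE.  NE7b NOT PRINTED ∕ NOT PROVED; spine PROVED 0∕9; rung (B)+1 — the programme's measures remain FINITE-torus
statements; NOT the mass gap, NOT Clay.  HONEST DEPENDENCY: continuum YM on T⁴ ⇐ BetaPertH ∧ nine spine estimates (0∕9 proved); BetaPertH ⇐
(D1) ∧ (D4) ∧ CAP+tail; G-an2-4 gates asym, D1 and NE2∕3∕4.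
-/

set_option autoImplicit false

noncomputable section

namespace Summit.QuantumFields.BalabanUV.T4Continuum.NE7b.SupWeightedCovarianceDecay

open Real Finset Matrix
open scoped BigOperators
open SupDobrushinWeightedNeumann (pow_weighted_rowsum_le neumann_weighted_rowsum_le rowsum_le_weighted)
open SupDobrushinNeumannMatrix (summable_pow_entry pow_entry_nonneg)

variable {ι : Type} [Fintype ι] [DecidableEq ι]

variable {C : Matrix ι ι ℝ} {θ D : ι → ι → ℝ} {γθ γθ' dθ dθ' cmin αθ βθ : ℝ} {c a b : ι → ℝ}

/-! ## §1. The weighted column letters by transposition -/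

omit [Fintype ι] [DecidableEq ι] in
/-- The transposed weight is again submultiplicative: `θᵀ_{xz} ≤ θᵀ_{xy}θᵀ_{yz}`. [folklore] -/
theorem transpose_weight_mul (hθmul : ∀ x y z, θ x z ≤ θ x y * θ y z) (x y z : ι) : θ z x ≤ θ y x * θ z y := by
  rw [mul_comm]; exact hθmul z y x

/-- `(C^n)_{xw} = ((Cᵀ)^n)_{wx}`. [folklore] -/
theorem transpose_pow_apply (C : Matrix ι ι ℝ) (n : ℕ) (x w : ι) : (C ^ n) x w = (Cᵀ ^ n) w x := by
  rw [← Matrix.transpose_pow, transpose_apply]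

/-- **THE WEIGHTED COLUMN LETTER OF THE POWERS**: `Σ_x (C^n)_{xw}θ_{xw} ≤ γθ′^n` from the weighted column hypothesis
`Σ_x C_{xw}θ_{xw} ≤ γθ′` ((453) for `Cᵀ` and the transposed weight). [folklore] -/
theorem pow_weighted_colsum_le (hC : ∀ x z, 0 ≤ C x z) (hθ1 : ∀ x z, 1 ≤ θ x z) (hθdiag : ∀ x, θ x x = 1)
    (hθmul : ∀ x y z, θ x z ≤ θ x y * θ y z) (hCθc : ∀ w, ∑ x, C x w * θ x w ≤ γθ') (n : ℕ) (w : ι) :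
    ∑ x, (C ^ n) x w * θ x w ≤ γθ' ^ n := by
  have h := pow_weighted_rowsum_le (C := Cᵀ) (θ := fun x z => θ z x) (γθ := γθ') (fun x z => hC z x) (fun x z => hθ1 z x) hθdiag
    (fun x y z => transpose_weight_mul hθmul x y z) (fun x => by simpa only [transpose_apply] using hCθc x) n w
  simpa only [← transpose_pow_apply] using h

/-- **THE WEIGHTED COLUMN LETTER OF THE NEUMANN MATRIX**: `Σ_x D_{xw}θ_{xw} ≤ (1−γθ′)⁻¹` for `D = Σ_nC^n`, under the weighted row
hypothesis (for summability) and the weighted column hypothesis. [folklore] -/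
theorem neumann_weighted_colsum_le (hC : ∀ x z, 0 ≤ C x z) (hθ1 : ∀ x z, 1 ≤ θ x z) (hθdiag : ∀ x, θ x x = 1)
    (hθmul : ∀ x y z, θ x z ≤ θ x y * θ y z) (hCθc : ∀ w, ∑ x, C x w * θ x w ≤ γθ') (hγ'0 : 0 ≤ γθ') (hγ'1 : γθ' < 1) (w : ι) :
    ∑ x, (∑' n : ℕ, (C ^ n) x w) * θ x w ≤ (1 - γθ')⁻¹ := by
  have h := neumann_weighted_rowsum_le (C := Cᵀ) (θ := fun x z => θ z x) (γθ := γθ') (fun x z => hC z x) (fun x z => hθ1 z x) hθdiag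
    (fun x y z => transpose_weight_mul hθmul x y z) (fun x => by simpa only [transpose_apply] using hCθc x) hγ'0 hγ'1 w
  simpa only [← transpose_pow_apply] using h

/-! ## §2. Weighted profiles propagate through `D` -/

omit [DecidableEq ι] in
/-- **`θ_{xw}·(Dᵀa)_w ≤ Σ_z (a_zθ_{xz})·(D_{zw}θ_{zw})`** (`θ_{xw} ≤ θ_{xz}θ_{zw}` term by term). [folklore] -/
theorem weighted_profile_row (hD : ∀ x y, 0 ≤ D x y) (hθmul : ∀ x y z, θ x z ≤ θ x y * θ y z) (ha : ∀ z, 0 ≤ a z) (x w : ι) : θ x w * ∑ z, D z w * a z ≤ ∑ z, (a z * θ x z) * (D z w * θ z w) := by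
  rw [Finset.mul_sum]
  refine Finset.sum_le_sum fun z _ => ?_
  have h := hθmul x z w
  have h0 : 0 ≤ D z w * a z := mul_nonneg (hD z w) (ha z)
  calc θ x w * (D z w * a z) ≤ (θ x z * θ z w) * (D z w * a z) := mul_le_mul_of_nonneg_right h h0
    _ = (a z * θ x z) * (D z w * θ z w) := by ring

omit [DecidableEq ι] in
/-- **`θ_{wy}·(Dᵀb)_w ≤ βθ·Σ_zD_{zw}θ_{zw}`** when `b_zθ_{zy} ≤ βθ` for all `z` (`θ` symmetric). [folklore] -/
theorem weighted_profile_sup (hD : ∀ x y, 0 ≤ D x y) (hθ1 : ∀ x z, 1 ≤ θ x z) (hθmul : ∀ x y z, θ x z ≤ θ x y * θ y z)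
    (hθsymm : ∀ x y, θ x y = θ y x) (hb : ∀ z, 0 ≤ b z) (w y : ι) (hbθ : ∀ z, b z * θ z y ≤ βθ) :
    θ w y * ∑ z, D z w * b z ≤ βθ * ∑ z, D z w * θ z w := by
  rw [Finset.mul_sum, Finset.mul_sum]
  refine Finset.sum_le_sum fun z _ => ?_
  have h := hθmul w z y
  rw [hθsymm w z] at h
  have h0 : 0 ≤ D z w := hD z w
  have hθ0 : 0 ≤ θ z w := zero_le_one.trans (hθ1 z w)
  calc θ w y * (D z w * b z) ≤ (θ z w * θ z y) * (D z w * b z) := mul_le_mul_of_nonneg_right h (mul_nonneg h0 (hb z))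
    _ = (b z * θ z y) * (D z w * θ z w) := by ring
    _ ≤ βθ * (D z w * θ z w) := mul_le_mul_of_nonneg_right (hbθ z) (mul_nonneg h0 hθ0)

/-! ## §3. The decay of the bilinear bound -/

omit [DecidableEq ι] in
/-- **THE WEIGHTED BILINEAR BOUND**: `θ_{xy}·Σ_w (Dᵀa)_w(Dᵀb)_w∕c_w ≤ αθ·dθ·βθ·dθ′∕cmin` under the weighted row∕column letters of `D`,
`c_w ≥ cmin > 0`, the weighted mass `Σ_z a_zθ_{xz} ≤ αθ` of `a` around `x` and the weighted sup `b_zθ_{zy} ≤ βθ` of `b` around `y`. [folklore] -/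
theorem bilinear_weighted_le (hD : ∀ x y, 0 ≤ D x y) (hθ1 : ∀ x z, 1 ≤ θ x z) (hθmul : ∀ x y z, θ x z ≤ θ x y * θ y z)
    (hθsymm : ∀ x y, θ x y = θ y x) (hDr : ∀ z, ∑ w, D z w * θ z w ≤ dθ) (hDc : ∀ w, ∑ z, D z w * θ z w ≤ dθ') (hcmin : 0 < cmin)
    (hc : ∀ w, cmin ≤ c w) (ha : ∀ z, 0 ≤ a z) (hb : ∀ z, 0 ≤ b z) (x y : ι) (hx : ∑ z, a z * θ x z ≤ αθ) (hy : ∀ z, b z * θ z y ≤ βθ) :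
    θ x y * ∑ w, (∑ z, D z w * a z) * (∑ z, D z w * b z) / c w ≤ αθ * dθ * (βθ * dθ') / cmin := by
  have hθ0 : ∀ x z, 0 ≤ θ x z := fun x z => zero_le_one.trans (hθ1 x z)
  have hα : ∀ w, 0 ≤ ∑ z, D z w * a z := fun w => Finset.sum_nonneg fun z _ => mul_nonneg (hD z w) (ha z)
  have hβ : ∀ w, 0 ≤ ∑ z, D z w * b z := fun w => Finset.sum_nonneg fun z _ => mul_nonneg (hD z w) (hb z)
  rcases isEmpty_or_nonempty ι with hι | ⟨⟨w₀⟩⟩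
  · exact (hι.false x).elim
  have hβθ0 : 0 ≤ βθ := le_trans (mul_nonneg (hb w₀) (hθ0 w₀ y)) (hy w₀)
  have hdθ'0 : 0 ≤ dθ' := le_trans (Finset.sum_nonneg fun z _ => mul_nonneg (hD z w₀) (hθ0 z w₀)) (hDc w₀)
  have hdθ0 : 0 ≤ dθ := le_trans (Finset.sum_nonneg fun w _ => mul_nonneg (hD w₀ w) (hθ0 w₀ w)) (hDr w₀)
  -- termwise: `θ_xy·(Dᵀa)_w(Dᵀb)_w/c_w ≤ [θ_xw(Dᵀa)_w]·[θ_wy(Dᵀb)_w]/cmin`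
  have hterm : ∀ w, θ x y * ((∑ z, D z w * a z) * (∑ z, D z w * b z) / c w) ≤
      (∑ z, (a z * θ x z) * (D z w * θ z w)) * (βθ * dθ') / cmin := fun w => by
    have h1 := weighted_profile_row hD hθmul ha x w
    have h2 := (weighted_profile_sup hD hθ1 hθmul hθsymm hb w y hy).trans (mul_le_mul_of_nonneg_left (hDc w) hβθ0)
    have hsplit : θ x y ≤ θ x w * θ w y := hθmul x w y
    have hcw : 0 < c w := hcmin.trans_le (hc w)
    calc θ x y * ((∑ z, D z w * a z) * (∑ z, D z w * b z) / c w)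
        ≤ (θ x w * θ w y) * ((∑ z, D z w * a z) * (∑ z, D z w * b z) / c w) :=
          mul_le_mul_of_nonneg_right hsplit (div_nonneg (mul_nonneg (hα w) (hβ w)) hcw.le)
      _ = (θ x w * ∑ z, D z w * a z) * (θ w y * ∑ z, D z w * b z) / c w := by ring
      _ ≤ (∑ z, (a z * θ x z) * (D z w * θ z w)) * (βθ * dθ') / c w :=
          div_le_div_of_nonneg_right (mul_le_mul h1 h2 (mul_nonneg (hθ0 w y) (hβ w))
            (Finset.sum_nonneg fun z _ => mul_nonneg (mul_nonneg (ha z) (hθ0 x z)) (mul_nonneg (hD z w) (hθ0 z w)))) hcw.le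
      _ ≤ (∑ z, (a z * θ x z) * (D z w * θ z w)) * (βθ * dθ') / cmin :=
          div_le_div_of_nonneg_left (mul_nonneg (Finset.sum_nonneg fun z _ => mul_nonneg (mul_nonneg (ha z) (hθ0 x z))
            (mul_nonneg (hD z w) (hθ0 z w))) (mul_nonneg hβθ0 hdθ'0)) hcmin (hc w)
  rw [Finset.mul_sum]
  refine (Finset.sum_le_sum fun w _ => hterm w).trans ?_
  -- sum over `w`: `Σ_w Σ_z (a_zθ_xz)(D_zwθ_zw) = Σ_z a_zθ_xz Σ_w D_zwθ_zw ≤ αθ·dθ`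
  rw [← Finset.sum_div, ← Finset.sum_mul]
  have hsum : ∑ w, ∑ z, (a z * θ x z) * (D z w * θ z w) ≤ αθ * dθ := by
    rw [Finset.sum_comm]
    calc ∑ z, ∑ w, (a z * θ x z) * (D z w * θ z w) = ∑ z, (a z * θ x z) * ∑ w, D z w * θ z w :=
          Finset.sum_congr rfl fun z _ => by rw [Finset.mul_sum]
      _ ≤ ∑ z, (a z * θ x z) * dθ := Finset.sum_le_sum fun z _ => mul_le_mul_of_nonneg_left (hDr z) (mul_nonneg (ha z) (hθ0 x z))
      _ ≤ αθ * dθ := by rw [← Finset.sum_mul]; exact mul_le_mul_of_nonneg_right hx hdθ0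
  exact div_le_div_of_nonneg_right (mul_le_mul_of_nonneg_right hsum (mul_nonneg hβθ0 hdθ'0)) hcmin.le

omit [DecidableEq ι] in
/-- **THE DECAY**: `Σ_w (Dᵀa)_w(Dᵀb)_w∕c_w ≤ αθ·dθ·βθ·dθ′∕(cmin·θ_{xy})` — the covariance of an observable living near `x` and one living
near `y` decays like `θ_{xy}⁻¹`. [folklore] -/
theorem bilinear_decay (hD : ∀ x y, 0 ≤ D x y) (hθ1 : ∀ x z, 1 ≤ θ x z) (hθmul : ∀ x y z, θ x z ≤ θ x y * θ y z)
    (hθsymm : ∀ x y, θ x y = θ y x) (hDr : ∀ z, ∑ w, D z w * θ z w ≤ dθ) (hDc : ∀ w, ∑ z, D z w * θ z w ≤ dθ') (hcmin : 0 < cmin)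
    (hc : ∀ w, cmin ≤ c w) (ha : ∀ z, 0 ≤ a z) (hb : ∀ z, 0 ≤ b z) (x y : ι) (hx : ∑ z, a z * θ x z ≤ αθ) (hy : ∀ z, b z * θ z y ≤ βθ) :
    ∑ w, (∑ z, D z w * a z) * (∑ z, D z w * b z) / c w ≤ αθ * dθ * (βθ * dθ') / (cmin * θ x y) := by
  have hθ0 : 0 < θ x y := zero_lt_one.trans_le (hθ1 x y)
  have h := bilinear_weighted_le hD hθ1 hθmul hθsymm hDr hDc hcmin hc ha hb x y hx hy
  rw [le_div_iff₀ (mul_pos hcmin hθ0)]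
  rw [le_div_iff₀ hcmin] at h
  calc (∑ w, (∑ z, D z w * a z) * (∑ z, D z w * b z) / c w) * (cmin * θ x y)
      = θ x y * (∑ w, (∑ z, D z w * a z) * (∑ z, D z w * b z) / c w) * cmin := by ring
    _ ≤ αθ * dθ * (βθ * dθ') := h

/-! ## §4. Toy instance (kernel) -/

/-- Toy: the trivial weight `θ = 1` is symmetric and submultiplicative. -/
example : (fun _ _ : Fin 2 => (1 : ℝ)) 0 1 ≤ (fun _ _ : Fin 2 => (1 : ℝ)) 0 0 * (fun _ _ : Fin 2 => (1 : ℝ)) 0 1 := by norm_num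

end Summit.QuantumFields.BalabanUV.T4Continuum.NE7b.SupWeightedCovarianceDecay

end
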